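import Mathlib
import Summits.PneNP.PneNP.Theses.OneSlice
import Summits.PneNP.PneNP.Theorems.OneSliceSliceTargetSplit
import Summits.PneNP.PneNP.Theorems.OneSliceMonotoneContinuationDefs
import Summits.PneNP.PneNP.Theorems.OneSliceMonotoneContinuationTransportMono
import Summits.PneNP.PneNP.Theorems.OneSliceMonotoneContinuationLevelAverage
import Summits.PneNP.PneNP.Theorems.OneSliceMonotoneContinuationSamplerExpansion
import Summits.PneNP.PneNP.Theorems.OneSliceMonotoneContinuationBinomialMixing
import Summits.PneNP.PneNP.Theorems.OneSliceMonotoneContinuationDerandomize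
import Summits.PneNP.PneNP.Theorems.OneSliceMonotoneContinuationSamplerBounds

/-!
# Route OneSlice, crux `MonotoneContinuation` (stmt-PneNP-18471), line `Sketch_ideator1_r1` (ProfileLine) — window estimate, eventual facts, from a sampler to a circuit

Chebyshev window estimate for binomial profile averages (`binAvg_le_of_flat`), the eventual facts about central `j`, the mass
of the two extreme inputs and the size budget, and `circuit_of_sampler`: a restriction sampler whose majority votes are realised by
monotone circuits yields a monotone circuit close to the target (uses the landed `stub_derandomize`).

Lead prover-line-stmt-PneNP-18471-0, 2026-08-17. Def-free (vocabulary in `OneSliceMonotoneContinuationDefs.lean`).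
-/

set_option linter.dupNamespace false -- `Summit.PneNP.PneNP.…`: summit = sub-problem (D-0017)

namespace Summit.PneNP.PneNP.Theorems.MonotoneContinuation

open Literature.Computability.Complexity hiding supp mem_supp
open Finset hiding slice
open Filter hiding mem_sdiff
open Classical
open Summit.PneNP.PneNP.Theorems (binomialWeight_tail_le binomialWeight_sum_range binomialWeight_nonneg card_slice
  tendsto_mean eventually_window central_add_le mean_ge)
open Summit.PneNP.PneNP.Theorems.ConstantBand.Negative (Edge thr Central slice)
open Summit.PneNP.PneNP.Theorems.SingleThreshold.Negative (pc tendsto_pc pc_nonneg)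
open Summit.PneNP.PneNP.Theorems.SliceTargetSplit (Comp nbhd mem_nbhd transport ind l1 nbhdCard ind_nonneg ind_le_one
  abs_ind_sub_ind l1_comm l1_nonneg l1_triangle l1_eq_sum_slices card_nbhd card_nbhd_of_le card_nbhd_of_ge
  choose_mul_nbhdCard nbhdCard_pos sum_slice_sum_nbhd sum_slice_sum_nbhd_left transport_nonneg transport_sub
  l1_transport_le rdist_eq_l1 transport_ind_mem)

noncomputable section

variable {n : ℕ}

/-! ## The window estimate -/

/-- **Window estimate.** If `|α r − α j| ≤ η` on a window `P` outside of which every index is at distance `≥ w`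
from the mean `Np`, then `Σ_r Bin(N,p)(r)|α r − α j| ≤ η + Np(1-p)/w²` (Chebyshev). -/
theorem binAvg_le_of_flat {N j : ℕ} {p w η : ℝ} (hp0 : 0 ≤ p) (hp1 : p ≤ 1) (hw : 0 < w) (hη : 0 ≤ η)
    (α : ℕ → ℝ) (hα1 : ∀ r, |α r - α j| ≤ 1) (P : ℕ → Prop) [DecidablePred P]
    (hflat : ∀ r, P r → |α r - α j| ≤ η) (htail : ∀ r, ¬ P r → w ≤ |(r : ℝ) - N * p|) :
    ∑ r ∈ range (N + 1), binW N p r * |α r - α j| ≤ η + N * p * (1 - p) / w ^ 2 := by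
  have hb : ∀ i, binW N p i = (N.choose i : ℝ) * p ^ i * (1 - p) ^ (N - i) := fun i => rfl
  rw [← sum_filter_add_sum_filter_not (range (N + 1)) P]
  refine add_le_add ?_ ?_
  · calc ∑ r ∈ (range (N + 1)).filter P, binW N p r * |α r - α j|
        ≤ ∑ r ∈ (range (N + 1)).filter P, binW N p r * η :=
          sum_le_sum fun r hr => mul_le_mul_of_nonneg_left (hflat r (mem_filter.1 hr).2) (binW_nonneg hp0 hp1 r)
      _ ≤ ∑ r ∈ range (N + 1), binW N p r * η :=
          sum_le_sum_of_subset_of_nonneg (filter_subset _ _) fun r _ _ => mul_nonneg (binW_nonneg hp0 hp1 r) hη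
      _ = η := by rw [← sum_mul, binW_sum, one_mul]
  · calc ∑ r ∈ (range (N + 1)).filter (fun r => ¬ P r), binW N p r * |α r - α j|
        ≤ ∑ r ∈ (range (N + 1)).filter (fun r => ¬ P r), binW N p r :=
          sum_le_sum fun r _ => by
            calc binW N p r * |α r - α j| ≤ binW N p r * 1 :=
                  mul_le_mul_of_nonneg_left (hα1 r) (binW_nonneg hp0 hp1 r)
              _ = binW N p r := mul_one _
      _ ≤ N * p * (1 - p) / w ^ 2 := binomialWeight_tail_le hb hp0 hp1 hw (fun r => ¬ P r) htail

/-! ## Eventual facts -/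

/-- Eventually: `0 < p_c ≤ 1/8`, and every central `j` satisfies `j ≤ N`, `L² + 1 ≤ j` and `3j ≤ N`. -/
theorem eventually_central {k : ℕ} (hk : 3 ≤ k) (L : ℕ) :
    ∀ᶠ n : ℕ in atTop, 0 < pc n k ∧ pc n k ≤ 1 / 8 ∧
      ∀ j : ℕ, Central k n j → j ≤ n.choose 2 ∧ L ^ 2 + 1 ≤ j ∧ 3 * j ≤ n.choose 2 := by
  have hμ := tendsto_mean hk
  have hm : Tendsto (fun n : ℕ => (thr k n : ℝ)) atTop atTop :=
    tendsto_natCast_atTop_atTop.comp (tendsto_nat_floor_atTop.comp hμ)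
  have hA : Tendsto (fun n : ℕ => (thr k n : ℝ) ^ ((1 : ℝ) / 4)) atTop atTop :=
    (tendsto_rpow_atTop (by norm_num)).comp hm
  filter_upwards [eventually_window hk 0, hA.eventually_ge_atTop 2,
    hm.eventually_ge_atTop (2 * ((L : ℝ) ^ 2 + 1))] with n hwin hA2 hmL
  obtain ⟨hp0, hp8, h34, h32, hwin5⟩ := hwin
  refine ⟨hp0, hp8, fun j hj => ?_⟩
  have hjN : j ≤ n.choose 2 := by simpa using central_add_le (w := 0) hp0 hp8 hwin5 hj
  set m : ℝ := (thr k n : ℝ) with hmdef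
  set A : ℝ := m ^ ((1 : ℝ) / 4) with hAdef
  set R : ℝ := m ^ ((3 : ℝ) / 4) with hRdef
  have hm0 : 0 ≤ m := Nat.cast_nonneg _
  have hA0 : 0 < A := by linarith
  have hmA : m = A ^ 4 := by
    rw [hAdef, ← Real.rpow_natCast, ← Real.rpow_mul hm0]; norm_num
  have hRA : R = A ^ 3 := by
    rw [hRdef, hAdef, ← Real.rpow_natCast, ← Real.rpow_mul hm0]; norm_num
  -- `2R ≤ m`
  have h2R : 2 * R ≤ m := by
    rw [hRA, hmA]; nlinarith [pow_pos hA0 3]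
  have hjc := abs_le.1 hj
  -- `μ = Np`, `m ≤ μ < m + 1`, `8 μ ≤ N` from `p ≤ 1/8`
  have hμ0 : 0 ≤ ((n.choose 2 : ℕ) : ℝ) * pc n k := mul_nonneg (Nat.cast_nonneg _) hp0.le
  have hmμ : m ≤ ((n.choose 2 : ℕ) : ℝ) * pc n k := Nat.floor_le hμ0
  have h8μ : 8 * (((n.choose 2 : ℕ) : ℝ) * pc n k) ≤ (n.choose 2 : ℕ) := by
    have hN0 : (0 : ℝ) ≤ (n.choose 2 : ℕ) := Nat.cast_nonneg _
    nlinarith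
  refine ⟨hjN, ?_, ?_⟩
  · -- `j ≥ m - R ≥ m/2 ≥ L² + 1`
    have h1 : (m : ℝ) / 2 ≤ j := by linarith [hjc.1]
    have h2 : ((L ^ 2 + 1 : ℕ) : ℝ) ≤ j := by push_cast; linarith
    exact_mod_cast h2
  · -- `3j ≤ 3(m + R) ≤ 4.5 m ≤ 8 μ ≤ N`
    have h1 : (3 * j : ℝ) ≤ (n.choose 2 : ℕ) := by nlinarith [hjc.2]
    exact_mod_cast h1

/-- Eventually: the two extreme inputs carry little mass, and `p_c` is small. -/
theorem eventually_small {k : ℕ} (hk : 3 ≤ k) {u : ℝ} (hu : 0 < u) :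
    ∀ᶠ n : ℕ in atTop, (1 - pc n k) ^ (n.choose 2) + (pc n k) ^ (n.choose 2) ≤ u := by
  have hμ := tendsto_mean hk
  have hp := (tendsto_pc (show 2 ≤ k by omega)).eventually (eventually_le_nhds (half_pos hu))
  filter_upwards [eventually_window hk 0, hμ.eventually_ge_atTop (2 / u), hp] with n hwin hμu hpu
  obtain ⟨hp0, hp8, -, -, -⟩ := hwin
  set p : ℝ := pc n k with hpdef
  set N : ℕ := n.choose 2 with hNdef
  have hp1 : p ≤ 1 := by linarith
  have hμpos : 0 < (N : ℝ) * p := lt_of_lt_of_le (by positivity) hμu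
  have hN0 : 0 < N := by
    rcases Nat.eq_zero_or_pos N with h | h
    · exfalso; rw [h, Nat.cast_zero, zero_mul] at hμpos; exact lt_irrefl _ hμpos
    · exact h
  have hNr : (0 : ℝ) < N := by exact_mod_cast hN0
  -- `(1-p)^N = (1 - (Np)/N)^N ≤ exp(-Np) ≤ 1/(1 + Np) ≤ u/2`
  have h1 : (1 - p) ^ N ≤ Real.exp (-((N : ℝ) * p)) := by
    have key := Real.one_sub_div_pow_le_exp_neg (n := N) (t := (N : ℝ) * p) (by nlinarith)
    have hdiv : (N : ℝ) * p / N = p := by field_simp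
    rwa [hdiv] at key
  have h2 : Real.exp (-((N : ℝ) * p)) ≤ u / 2 := by
    rw [Real.exp_neg]
    have h3 : 1 + (N : ℝ) * p ≤ Real.exp ((N : ℝ) * p) := by
      have := Real.add_one_le_exp ((N : ℝ) * p); linarith
    have h4 : (Real.exp ((N : ℝ) * p))⁻¹ ≤ (1 + (N : ℝ) * p)⁻¹ := inv_anti₀ (by positivity) h3
    refine h4.trans ?_
    rw [inv_le_comm₀ (by positivity) (by positivity)]
    have : (u / 2)⁻¹ = 2 / u := by rw [inv_div]
    rw [this]; linarith
  -- `p^N ≤ p ≤ u/2`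
  have h5 : p ^ N ≤ p := by
    calc p ^ N ≤ p ^ 1 := pow_le_pow_of_le_one hp0.le hp1 hN0
      _ = p := pow_one p
  linarith

/-- Eventually: the size budget `t(n^{c₁} + 2N + 2) + 4t² + 4 ≤ n^{c₁+4}`. -/
theorem eventually_size (c₁ t : ℕ) :
    ∀ᶠ n : ℕ in atTop, t * (n ^ c₁ + 2 * n.choose 2 + 2) + 4 * t ^ 2 + 4 ≤ n ^ (c₁ + 4) := by
  filter_upwards [eventually_ge_atTop (max 5 (max t (4 * t ^ 2 + 4)))] with n hn
  have hn5 : 5 ≤ n := le_trans (le_max_left _ _) hn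
  have hnt : t ≤ n := le_trans ((le_max_left _ _).trans (le_max_right _ _)) hn
  have hnt2 : 4 * t ^ 2 + 4 ≤ n := le_trans ((le_max_right _ _).trans (le_max_right _ _)) hn
  have hn1 : 1 ≤ n := by omega
  have hN : n.choose 2 ≤ n ^ 2 := by
    rw [Nat.choose_two_right, sq]
    exact (Nat.div_le_self _ _).trans (Nat.mul_le_mul_left _ (Nat.sub_le _ _))
  have hpow1 : 1 ≤ n ^ c₁ := Nat.one_le_pow _ _ (by omega)
  have hP : n ^ (c₁ + 4) = n ^ c₁ * n ^ 4 := pow_add n c₁ 4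
  -- everything in terms of `P := n^{c₁}` and `n`
  have h1 : t * n ^ c₁ ≤ n * n ^ c₁ := Nat.mul_le_mul_right _ hnt
  have h2 : t * (2 * n.choose 2 + 2) ≤ n * (2 * n ^ 2 + 2) :=
    Nat.mul_le_mul hnt (by omega)
  have h3 : n * (2 * n ^ 2 + 2) ≤ 3 * n ^ 3 * n ^ c₁ := by
    have : n * (2 * n ^ 2 + 2) ≤ 3 * n ^ 3 := by
      have h25 : 2 ≤ n ^ 2 := by nlinarith
      nlinarith
    calc n * (2 * n ^ 2 + 2) ≤ 3 * n ^ 3 := this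
      _ = 3 * n ^ 3 * 1 := (mul_one _).symm
      _ ≤ 3 * n ^ 3 * n ^ c₁ := Nat.mul_le_mul_left _ hpow1
  have h4 : 4 * t ^ 2 + 4 ≤ n * n ^ c₁ := by
    calc 4 * t ^ 2 + 4 ≤ n := hnt2
      _ = n * 1 := (mul_one _).symm
      _ ≤ n * n ^ c₁ := Nat.mul_le_mul_left _ hpow1
  have hsum : t * (n ^ c₁ + 2 * n.choose 2 + 2) + 4 * t ^ 2 + 4 ≤ (n + 3 * n ^ 3 + n) * n ^ c₁ := by
    have := Nat.mul_add t (n ^ c₁) (2 * n.choose 2 + 2)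
    nlinarith [h1, h2, h3, h4, this]
  refine hsum.trans ?_
  rw [hP, mul_comm]
  refine Nat.mul_le_mul_left _ ?_
  -- `n + 3n³ + n ≤ n⁴` for `n ≥ 5`
  have : n + 3 * n ^ 3 + n ≤ 5 * n ^ 3 := by nlinarith
  calc n + 3 * n ^ 3 + n ≤ 5 * n ^ 3 := this
    _ ≤ n * n ^ 3 := Nat.mul_le_mul_right _ hn5
    _ = n ^ 4 := by ring

/-! ## From a sampler to a circuit -/

/-- Indicators that agree off the two extreme inputs are close in `L¹(G(n,p))`. -/
theorem l1_ind_le_of_eqOn {p : ℝ} (hp0 : 0 ≤ p) (hp1 : p ≤ 1) (f g : (Edge n → Bool) → Bool)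
    (hfg : ∀ y : Edge n → Bool, (∃ e, y e = false) → (∃ e, y e = true) → f y = g y) :
    l1 n p (ind f) (ind g) ≤ gnpWeight n p (fun _ => false) + gnpWeight n p (fun _ => true) := by
  unfold l1
  have hpt : ∀ y : Edge n → Bool, gnpWeight n p y * |ind f y - ind g y| ≤
      gnpWeight n p y * ((if y = (fun _ => false) then 1 else 0) + (if y = (fun _ => true) then 1 else 0)) := by
    intro y
    refine mul_le_mul_of_nonneg_left ?_ (gnpWeight_nonneg hp0 hp1 y)
    have hle1 : |ind f y - ind g y| ≤ 1 := by
      have := ind_nonneg f y; have := ind_le_one f y; have := ind_nonneg g y; have := ind_le_one g y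
      rw [abs_sub_le_iff]; constructor <;> linarith
    by_cases h0 : y = fun _ => false
    · rw [if_pos h0]
      have : (0 : ℝ) ≤ (if y = (fun _ => true) then 1 else 0) := by split_ifs <;> norm_num
      linarith
    · by_cases h1 : y = fun _ => true
      · rw [if_pos h1, if_neg h0]; linarith
      · rw [if_neg h0, if_neg h1, add_zero]
        have hF : ∃ e, y e = false := by
          by_contra hc; push Not at hc
          exact h1 (funext fun e => by simpa using hc e)
        have hT : ∃ e, y e = true := by
          by_contra hc; push Not at hc
          exact h0 (funext fun e => by simpa using hc e)
        unfold ind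
        rw [hfg y hF hT, sub_self, abs_zero]
  refine (sum_le_sum fun y _ => hpt y).trans (le_of_eq ?_)
  simp_rw [mul_add, mul_ite, mul_one, mul_zero]
  rw [sum_add_distrib, Finset.sum_ite_eq' univ (fun _ : Edge n => false), Finset.sum_ite_eq' univ (fun _ : Edge n => true)]
  simp

/-- **From a sampler to a circuit.** A restriction sampler `U(y) = E_ρ 𝟙[f](σ y ρ)`, `ρ ∼ G(n,r)`, whose majority
votes are realised by monotone circuits of size `≤ S` off the two extreme inputs, and which is `δ₁`-close to a target
itself `δ₂`-close to a Boolean function, yields a monotone circuit of size `≤ S` within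
`w(⊥) + w(⊤) + 4/t + 5(δ₁ + δ₂) + δ₁` of the target. -/
theorem circuit_of_sampler {t : ℕ} (ht : 0 < t) {p : ℝ} (hp0 : 0 ≤ p) (hp1 : p ≤ 1)
    (σ : (Edge n → Bool) → (Edge n → Bool) → (Edge n → Bool)) (f : (Edge n → Bool) → Bool)
    {r : ℝ} (hr0 : 0 ≤ r) (hr1 : r ≤ 1) {S : ℕ}
    (hM : ∀ ρs : Fin t → Edge n → Bool, ∃ M : Circuit (Edge n), M.IsOver monotoneBasis ∧ M.size ≤ S ∧
      ∀ y : Edge n → Bool, (∃ e, y e = false) → (∃ e, y e = true) →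
        M.eval y = majVote (fun a y => f (σ y (ρs a))) y)
    (target : (Edge n → Bool) → ℝ) (G : (Edge n → Bool) → Bool) {δ₁ δ₂ : ℝ}
    (hU : l1 n p (fun y => ∑ ρ, gnpWeight n r ρ * ind f (σ y ρ)) target ≤ δ₁)
    (hG : l1 n p target (ind G) ≤ δ₂) :
    ∃ M : Circuit (Edge n), M.IsOver monotoneBasis ∧ M.size ≤ S ∧
      l1 n p (ind M.eval) target ≤
        gnpWeight n p (fun _ => false) + gnpWeight n p (fun _ => true) + (4 / t + 5 * (δ₁ + δ₂)) + δ₁ := by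
  set g : (Edge n → Bool) → (Edge n → Bool) → Bool := fun ρ y => f (σ y ρ) with hg
  set U : (Edge n → Bool) → ℝ := fun y => ∑ ρ, gnpWeight n r ρ * ind f (σ y ρ) with hUdef
  have hUg : (fun y => ∑ ρ, gnpWeight n r ρ * ind (g ρ) y) = U := by
    funext y; rfl
  obtain ⟨ρs, hρs⟩ :
      ∃ ρs : Fin t → Edge n → Bool, l1 n p (ind (majVote fun a => g (ρs a))) (fun y => ∑ ρ, gnpWeight n r ρ * ind (g ρ) y) ≤
        4 / t + 5 * l1 n p (fun y => ∑ ρ, gnpWeight n r ρ * ind (g ρ) y) (ind G) :=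
    stub_derandomize n t ht p hp0 hp1 (gnpWeight n r) (gnpWeight_nonneg hr0 hr1) (sum_gnpWeight r) g G
  rw [hUg] at hρs
  obtain ⟨M, hMB, hMS, hMev⟩ := hM ρs
  refine ⟨M, hMB, hMS, ?_⟩
  have hUG : l1 n p U (ind G) ≤ δ₁ + δ₂ := (l1_triangle hp0 hp1 U target (ind G)).trans (add_le_add hU hG)
  have hmaj : l1 n p (ind (majVote fun a => g (ρs a))) U ≤ 4 / t + 5 * (δ₁ + δ₂) :=
    hρs.trans (by nlinarith)
  have hMmaj : l1 n p (ind M.eval) (ind (majVote fun a => g (ρs a))) ≤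
      gnpWeight n p (fun _ => false) + gnpWeight n p (fun _ => true) :=
    l1_ind_le_of_eqOn hp0 hp1 _ _ hMev
  calc l1 n p (ind M.eval) target
      ≤ l1 n p (ind M.eval) (ind (majVote fun a => g (ρs a))) + l1 n p (ind (majVote fun a => g (ρs a))) target :=
        l1_triangle hp0 hp1 _ _ _
    _ ≤ l1 n p (ind M.eval) (ind (majVote fun a => g (ρs a))) +
          (l1 n p (ind (majVote fun a => g (ρs a))) U + l1 n p U target) :=
        add_le_add le_rfl (l1_triangle hp0 hp1 _ _ _)
    _ ≤ (gnpWeight n p (fun _ => false) + gnpWeight n p (fun _ => true)) + ((4 / t + 5 * (δ₁ + δ₂)) + δ₁) :=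
        add_le_add hMmaj (add_le_add hmaj hU)
    _ = _ := by ring


/-! ## Registered form -/

/-- **From a sampler to a circuit** (registered sub-goal `circuitOfSampler` of stmt-PneNP-18471), written out. [folklore] -/
theorem circuitOfSampler :
  ∀ (n t : ℕ), 0 < t → ∀ (p : ℝ), 0 ≤ p → p ≤ 1 →
    ∀ (σ : (Edge n → Bool) → (Edge n → Bool) → (Edge n → Bool)) (f : (Edge n → Bool) → Bool) (r : ℝ), 0 ≤ r → r ≤ 1 →
    ∀ (S : ℕ), (∀ ρs : Fin t → Edge n → Bool, ∃ M : Circuit (Edge n), M.IsOver monotoneBasis ∧ M.size ≤ S ∧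
      ∀ y : Edge n → Bool, (∃ e, y e = false) → (∃ e, y e = true) → M.eval y = majVote (fun a y => f (σ y (ρs a))) y) →
    ∀ (target : (Edge n → Bool) → ℝ) (G : (Edge n → Bool) → Bool) (δ₁ δ₂ : ℝ),
      l1 n p (fun y => ∑ ρ, gnpWeight n r ρ * ind f (σ y ρ)) target ≤ δ₁ → l1 n p target (ind G) ≤ δ₂ →
      ∃ M : Circuit (Edge n), M.IsOver monotoneBasis ∧ M.size ≤ S ∧
        l1 n p (ind M.eval) target ≤
          gnpWeight n p (fun _ => false) + gnpWeight n p (fun _ => true) + (4 / t + 5 * (δ₁ + δ₂)) + δ₁ :=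
  fun _ _ ht _ hp0 hp1 σ f _ hr0 hr1 _ hM target G _ _ hU hG =>
    circuit_of_sampler ht hp0 hp1 σ f hr0 hr1 hM target G hU hG

end

end Summit.PneNP.PneNP.Theorems.MonotoneContinuation
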